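import Summits.CriticalPhenomena.CardyFormulaZ2.Theorems.CardyWickAnisotropyBoxFamilyToCardyTransport
import HarnessLib

/-!
# Crux `BoxFamilyToCardy` (stmt-CriticalPhenomena-14215): the registered cut is lossless

Route `CardyWickAnisotropy` of `CardyFormulaZ2`, crux `BoxFamilyToCardy : AnisotropicBoxCardy →
CardyFormulaZ2` (line `Cruxes/BoxFamilyToCardy/Lines/birth.lean`, lead c4, 2026-08-17).

After leads c1–c3 the line is closed modulo exactly two registered stubs: the PRINTED statement
DKKMO 2020 Thm. 2.1 (`q = 1`, `d_SS` half; named fact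
`Literature.Probability.Percolation.DKKMO2020_thm21_schrammSmirnov`, the route's needs-fact debt) and the
rectilinear heart S1 `stub_rectilinearInvariance` (asymptotic equality of the bond-`ℤ²` crossing
probabilities of RECTILINEAR conformal rectangles of equal modulus — verbatim the heart of the shared
sibling crux `CardyMonotoneApproach.ConfInvTransport`, stmt-CriticalPhenomena-0794). This file proves,
sorry-free and over tree theorems only, that this cut loses nothing — S1 is not merely sufficient but
NECESSARY:

* `rectilinearInvariance_of_cardyFormulaZ2` — the conjunct implies S1 (both crossing probabilities
  tend to `F(η)`);
* `confInvTransport_of_cardyFormulaZ2` — the conjunct implies the transport crux stmt-0794;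
* `cardyFormulaZ2_of_confInvTransport_of_rectCardy` — transport + Cardy on corner-marked rectangles
  give the conjunct (Step 2 of `CardyMonotoneApproach.closes`, by name);
* `rectilinearInvariance_iff_cardyFormulaZ2_of_rectCardy`,
  `confInvTransport_iff_cardyFormulaZ2_of_rectCardy`,
  `confInvTransport_iff_rectilinearInvariance_of_rectCardy` — given Cardy on corner-marked rectangles
  (`RectCardy`, stmt-CriticalPhenomena-5843), S1, `ConfInvTransport` and `CardyFormulaZ2` are EQUIVALENT;
* `rectilinearInvariance_of_boxFamilyToCardy` — the crux and the route's target give S1 (no DKKMO);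
* `boxFamilyToCardy_iff_rectilinearInvariance`, `boxFamilyToCardy_iff_confInvTransport` — **modulo the
  printed DKKMO Thm. 2.1 the crux IS `AnisotropicBoxCardy → S1`, equivalently
  `AnisotropicBoxCardy → ConfInvTransport`.**

Consequently no reshaping of this line (or any other line for this crux that passes through Cardy on
rectangles) can avoid S1: the crux's open residue is exactly the open residue of stmt-0794, i.e.
conformal invariance of bond-`ℤ²` crossing probabilities on the rectilinear class (Schramm, ICM 2006,
Problem 2.11), to which the barrier `Literature.Barriers.CriticalPhenomena.EmbeddingModulusUniqueness`
applies. S1 is spelled out verbatim wherever it occurs (it is the registered stub statement; no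
definition is introduced); no named fact is taken as an axiom (DKKMO's theorem enters as a hypothesis).

References: O. Schramm, Proc. ICM 2006, §2.6 Problem 2.11; DKKMO, arXiv:2012.11672, Thm. 2.1;
S. Smirnov, C. R. Acad. Sci. 333 (2001), Thm. 1 and closing remark.
-/

noncomputable section

open Filter Topology Set
open Literature.Probability.RandomPlanarGeometry
open Literature.Probability.Percolation (bondDomainCrossingProb DKKMO2020_thm21_schrammSmirnov)
open Summit.CriticalPhenomena.CardyFormulaZ2.Theses.CardyWickAnisotropy (AnisotropicBoxCardy
  BoxFamilyToCardy)
open Summit.CriticalPhenomena.CardyFormulaZ2.Theses.CardyMonotoneApproach (RectCardy ConfInvTransport)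

namespace Summit.CriticalPhenomena.CardyFormulaZ2.Cruxes.BoxFamilyToCardy.Birth

/-- **The conjunct implies the rectilinear heart S1.** If Cardy's formula holds for every conformal
rectangle of bond-`ℤ²` (`CardyFormulaZ2`), then for conformal rectangles `Q, Q'` (rectilinear or not)
with uniformizing data `(ψ, y)`, `(ψ', y')` of equal cross-ratio the crossing probabilities are
asymptotically equal: both tend to `F(crossRatio y) = F(crossRatio y')`, so their difference tends to
`0`. Hence S1 is a NECESSARY condition for the conjunct. [folklore] -/
theorem rectilinearInvariance_of_cardyFormulaZ2 : CardyFormulaZ2 → (∀ (Q Q' : Literature.Probability.RandomPlanarGeometry.ConformalRectangle), (∃ S : Finset (ℂ × ℂ), (∀ p ∈ S, p.1.re = p.2.re ∨ p.1.im = p.2.im) ∧ frontier Q.carrier ⊆ ⋃ p ∈ S, segment ℝ p.1 p.2) → (∃ S : Finset (ℂ × ℂ), (∀ p ∈ S, p.1.re = p.2.re ∨ p.1.im = p.2.im) ∧ frontier Q'.carrier ⊆ ⋃ p ∈ S, segment ℝ p.1 p.2) → ∀ (ψ : Literature.Probability.RandomPlanarGeometry.ConformalEquiv UpperHalfPlane.upperHalfPlaneSet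 Q.carrier) (y : Fin 4 → ℝ) (ψ' : Literature.Probability.RandomPlanarGeometry.ConformalEquiv UpperHalfPlane.upperHalfPlaneSet Q'.carrier) (y' : Fin 4 → ℝ), Q.IsUniformizing ψ y → Q'.IsUniformizing ψ' y' → Literature.Probability.RandomPlanarGeometry.crossRatio y = Literature.Probability.RandomPlanarGeometry.crossRatio y' → Filter.Tendsto (fun δ : ℝ ↦ Literature.Probability.Percolation.bondDomainCrossingProb Q δ - Literature.Probability.Percolation.bondDomainCrossingProb Q' δ) (nhdsWithin (0 : ℝ) (Set.Ioi 0)) (nhds 0)) := by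
  intro hC Q Q' _ _ ψ y ψ' y' hQ hQ' hyy'
  have h₁ : Tendsto (bondDomainCrossingProb Q) (𝓝[>] 0) (𝓝 (cardyFunction (crossRatio y))) :=
    hC Q ψ y hQ
  have h₂ : Tendsto (bondDomainCrossingProb Q') (𝓝[>] 0) (𝓝 (cardyFunction (crossRatio y'))) :=
    hC Q' ψ' y' hQ'
  rw [← hyy'] at h₂
  have h := h₁.sub h₂
  rwa [sub_self] at h

/-- **The conjunct implies the transport crux** (`CardyMonotoneApproach.ConfInvTransport`,
stmt-CriticalPhenomena-0794, by name): under `CardyFormulaZ2`, if `R, R'` have uniformizing data of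
equal cross-ratio `η` and `P_δ(R) → L`, then `L = F(η)` by uniqueness of limits along the proper filter
`𝓝[>] 0`, and `P_δ(R') → F(η) = L`. [folklore] -/
theorem confInvTransport_of_cardyFormulaZ2 : CardyFormulaZ2 → ConfInvTransport := by
  intro hC R R' φ x φ' x' hR hR' hxx' L hL
  have h₁ : Tendsto (bondDomainCrossingProb R) (𝓝[>] 0) (𝓝 (cardyFunction (crossRatio x))) :=
    hC R φ x hR
  have hLF : L = cardyFunction (crossRatio x) := tendsto_nhds_unique hL h₁
  have h₂ : Tendsto (bondDomainCrossingProb R') (𝓝[>] 0) (𝓝 (cardyFunction (crossRatio x'))) :=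
    hC R' φ' x' hR'
  rwa [← hxx', ← hLF] at h₂

/-- **Transport plus Cardy on corner-marked rectangles give the conjunct** (Step 2 of the deciding
theorem of route `CardyMonotoneApproach`, by name): for a conformal rectangle `R'` with uniformizing
datum `(φ', x')`, realise `η' = crossRatio x' ∈ (0,1)` as the modulus of a corner-marked axis-parallel
rectangle `R` (`exists_rect_datum_of_mem_Ioo`), read Cardy's value on `R` (`RectCardy`), and transport
the limit to `R'` (`ConfInvTransport`). [folklore] -/
theorem cardyFormulaZ2_of_confInvTransport_of_rectCardy :
    ConfInvTransport → RectCardy → CardyFormulaZ2 := by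
  intro hCIT hRC R' φ' x' h'
  obtain ⟨R, w, h, φ, x, hw, hh, hcar, hpt, hφx, hη⟩ :=
    exists_rect_datum_of_mem_Ioo (ConformalRectangle.crossRatio_mem_Ioo_of_isUniformizing h')
  have hlim : Tendsto (bondDomainCrossingProb R) (𝓝[>] 0) (𝓝 (cardyFunction (crossRatio x))) :=
    hRC R w h hw hh hcar hpt φ x hφx
  have hlim' := hCIT R R' φ x φ' x' hφx h' hη _ hlim
  rw [hη] at hlim'
  exact hlim'

/-- **Given Cardy on corner-marked rectangles, S1 is equivalent to the conjunct.** (`→`) is lead c3's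
`cardyFormulaZ2_of_rectilinearInvariance_of_rectCardy` (S1 with the landed S2, S3 gives the transport,
then Step 2); (`←`) is `rectilinearInvariance_of_cardyFormulaZ2`. [folklore] -/
theorem rectilinearInvariance_iff_cardyFormulaZ2_of_rectCardy (hRC : RectCardy) :
    (∀ (Q Q' : Literature.Probability.RandomPlanarGeometry.ConformalRectangle), (∃ S : Finset (ℂ × ℂ), (∀ p ∈ S, p.1.re = p.2.re ∨ p.1.im = p.2.im) ∧ frontier Q.carrier ⊆ ⋃ p ∈ S, segment ℝ p.1 p.2) → (∃ S : Finset (ℂ × ℂ), (∀ p ∈ S, p.1.re = p.2.re ∨ p.1.im = p.2.im) ∧ frontier Q'.carrier ⊆ ⋃ p ∈ S, segment ℝ p.1 p.2) → ∀ (ψ : Literature.Probability.RandomPlanarGeometry.ConformalEquiv UpperHalfPlane.upperHalfPlaneSet Q.carrier) (y : Fin 4 → ℝ) (ψ' : Literature.Probability.RandomPlanarGeometry.ConformalEquiv UpperHalfPlane.upperHalfPlaneSet Q'.carrier) (y' : Fin 4 → ℝ), Q.IsUniformizing ψ y → Q'.IsUniformizing ψ' y' → Literature.Probability.RandomPlanarGeometry.crossRatio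 y = Literature.Probability.RandomPlanarGeometry.crossRatio y' → Filter.Tendsto (fun δ : ℝ ↦ Literature.Probability.Percolation.bondDomainCrossingProb Q δ - Literature.Probability.Percolation.bondDomainCrossingProb Q' δ) (nhdsWithin (0 : ℝ) (Set.Ioi 0)) (nhds 0)) ↔ CardyFormulaZ2 :=
  ⟨fun h₁ => cardyFormulaZ2_of_rectilinearInvariance_of_rectCardy h₁ hRC,
    rectilinearInvariance_of_cardyFormulaZ2⟩

/-- **Given Cardy on corner-marked rectangles, the transport crux is equivalent to the conjunct.**
(`→`) `cardyFormulaZ2_of_confInvTransport_of_rectCardy`; (`←`) `confInvTransport_of_cardyFormulaZ2`.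
[folklore] -/
theorem confInvTransport_iff_cardyFormulaZ2_of_rectCardy (hRC : RectCardy) :
    ConfInvTransport ↔ CardyFormulaZ2 :=
  ⟨fun hCIT => cardyFormulaZ2_of_confInvTransport_of_rectCardy hCIT hRC,
    confInvTransport_of_cardyFormulaZ2⟩

/-- **Given Cardy on corner-marked rectangles, the transport crux stmt-0794 is equivalent to its
registered heart S1** — the cut S1/S2/S3 of `Cruxes/ConfInvTransport/Lines/birth.lean` (S2, S3 landed)
is lossless on the sub-problem's critical path. [folklore] -/
theorem confInvTransport_iff_rectilinearInvariance_of_rectCardy (hRC : RectCardy) :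
    ConfInvTransport ↔ (∀ (Q Q' : Literature.Probability.RandomPlanarGeometry.ConformalRectangle), (∃ S : Finset (ℂ × ℂ), (∀ p ∈ S, p.1.re = p.2.re ∨ p.1.im = p.2.im) ∧ frontier Q.carrier ⊆ ⋃ p ∈ S, segment ℝ p.1 p.2) → (∃ S : Finset (ℂ × ℂ), (∀ p ∈ S, p.1.re = p.2.re ∨ p.1.im = p.2.im) ∧ frontier Q'.carrier ⊆ ⋃ p ∈ S, segment ℝ p.1 p.2) → ∀ (ψ : Literature.Probability.RandomPlanarGeometry.ConformalEquiv UpperHalfPlane.upperHalfPlaneSet Q.carrier) (y : Fin 4 → ℝ) (ψ' : Literature.Probability.RandomPlanarGeometry.ConformalEquiv UpperHalfPlane.upperHalfPlaneSet Q'.carrier) (y' : Fin 4 → ℝ), Q.IsUniformizing ψ y → Q'.IsUniformizing ψ' y' → Literature.Probability.RandomPlanarGeometry.crossRatio y = Literature.Probability.RandomPlanarGeometry.crossRatio y' → Filter.Tendsto (fun δ : ℝ ↦ Literature.Probability.Percolation.bondDomainCrossingProb Q δ - Literature.Probability.Percolation.bondDomainCrossingProb Q' δ) (nhdsWithin (0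 : ℝ) (Set.Ioi 0)) (nhds 0)) :=
  (confInvTransport_iff_cardyFormulaZ2_of_rectCardy hRC).trans
    (rectilinearInvariance_iff_cardyFormulaZ2_of_rectCardy hRC).symm

/-- **The crux and the route's target give S1, unconditionally** (no DKKMO): `BoxFamilyToCardy` and
`AnisotropicBoxCardy` give the conjunct, which gives S1 (`rectilinearInvariance_of_cardyFormulaZ2`).
[folklore] -/
theorem rectilinearInvariance_of_boxFamilyToCardy : BoxFamilyToCardy → AnisotropicBoxCardy → (∀ (Q Q' : Literature.Probability.RandomPlanarGeometry.ConformalRectangle), (∃ S : Finset (ℂ × ℂ), (∀ p ∈ S, p.1.re = p.2.re ∨ p.1.im = p.2.im) ∧ frontier Q.carrier ⊆ ⋃ p ∈ S, segment ℝ p.1 p.2) → (∃ S : Finset (ℂ × ℂ), (∀ p ∈ S, p.1.re = p.2.re ∨ p.1.im = p.2.im) ∧ frontier Q'.carrier ⊆ ⋃ p ∈ S, segment ℝ p.1 p.2) → ∀ (ψ : Literature.Probability.RandomPlanarGeometry.ConformalEquiv UpperHalfPlane.upperHalfPlaneSet Q.carrier) (y : Fin 4 → ℝ) (ψ' : Literature.Probability.RandomPlanarGeometry.ConformalEquiv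 UpperHalfPlane.upperHalfPlaneSet Q'.carrier) (y' : Fin 4 → ℝ), Q.IsUniformizing ψ y → Q'.IsUniformizing ψ' y' → Literature.Probability.RandomPlanarGeometry.crossRatio y = Literature.Probability.RandomPlanarGeometry.crossRatio y' → Filter.Tendsto (fun δ : ℝ ↦ Literature.Probability.Percolation.bondDomainCrossingProb Q δ - Literature.Probability.Percolation.bondDomainCrossingProb Q' δ) (nhdsWithin (0 : ℝ) (Set.Ioi 0)) (nhds 0)) :=
  fun hB hA => rectilinearInvariance_of_cardyFormulaZ2 (hB hA)

/-- **Modulo the printed DKKMO Thm. 2.1, the crux IS `AnisotropicBoxCardy → S1`.** Given the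
Schramm–Smirnov half of DKKMO 2020 Thm. 2.1 at `q = 1` (`DKKMO2020_thm21_schrammSmirnov`, printed,
unproved in the tree): (`→`) the crux and the target give the conjunct, hence S1
(`rectilinearInvariance_of_boxFamilyToCardy`; this direction does not use DKKMO); (`←`) given the
target, the known half (`isotropicRectangles_of_thm21SS`) gives Cardy on corner-marked rectangles, and
S1 with it gives the conjunct (`cardyFormulaZ2_of_rectilinearInvariance_of_rectCardy`). So the line's
registered open stub is exactly the crux's open residue: nothing weaker than S1 can close the line.
[cite: DKKMO2020Rotational, Thm. 2.1 (q = 1)] -/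
theorem boxFamilyToCardy_iff_rectilinearInvariance : Literature.Probability.Percolation.DKKMO2020_thm21_schrammSmirnov → (Summit.CriticalPhenomena.CardyFormulaZ2.Theses.CardyWickAnisotropy.BoxFamilyToCardy ↔ (Summit.CriticalPhenomena.CardyFormulaZ2.Theses.CardyWickAnisotropy.AnisotropicBoxCardy → ∀ (Q Q' : Literature.Probability.RandomPlanarGeometry.ConformalRectangle), (∃ S : Finset (ℂ × ℂ), (∀ p ∈ S, p.1.re = p.2.re ∨ p.1.im = p.2.im) ∧ frontier Q.carrier ⊆ ⋃ p ∈ S, segment ℝ p.1 p.2) → (∃ S : Finset (ℂ × ℂ), (∀ p ∈ S, p.1.re = p.2.re ∨ p.1.im = p.2.im) ∧ frontier Q'.carrier ⊆ ⋃ p ∈ S, segment ℝ p.1 p.2) → ∀ (ψ : Literature.Probability.RandomPlanarGeometry.ConformalEquiv UpperHalfPlane.upperHalfPlaneSet Q.carrier) (y : Fin 4 → ℝ) (ψ' : Literature.Probability.RandomPlanarGeometry.ConformalEquiv UpperHalfPlane.upperHalfPlaneSet Q'.carrier) (y' : Fin 4 → ℝ), Q.IsUniformizing ψ y → Q'.IsUniformizing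 ψ' y' → Literature.Probability.RandomPlanarGeometry.crossRatio y = Literature.Probability.RandomPlanarGeometry.crossRatio y' → Filter.Tendsto (fun δ : ℝ ↦ Literature.Probability.Percolation.bondDomainCrossingProb Q δ - Literature.Probability.Percolation.bondDomainCrossingProb Q' δ) (nhdsWithin (0 : ℝ) (Set.Ioi 0)) (nhds 0))) := by
  intro hSS
  refine ⟨rectilinearInvariance_of_boxFamilyToCardy, fun h hA => ?_⟩
  exact cardyFormulaZ2_of_rectilinearInvariance_of_rectCardy (h hA)
    (isotropicRectangles_of_thm21SS hSS hA)

/-- **Modulo the printed DKKMO Thm. 2.1, the crux IS `AnisotropicBoxCardy → ConfInvTransport`**, i.e.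
"the route's target implies the shared sibling crux stmt-CriticalPhenomena-0794": (`→`) the crux and
the target give the conjunct, hence the transport (`confInvTransport_of_cardyFormulaZ2`, no DKKMO);
(`←`) lead c2's `boxFamilyToCardy_of_thm21SS_of_confInvTransport`.
[cite: DKKMO2020Rotational, Thm. 2.1 (q = 1)] -/
theorem boxFamilyToCardy_iff_confInvTransport (hSS : DKKMO2020_thm21_schrammSmirnov) :
    BoxFamilyToCardy ↔ (AnisotropicBoxCardy → ConfInvTransport) :=
  ⟨fun hB hA => confInvTransport_of_cardyFormulaZ2 (hB hA),
    fun h hA => boxFamilyToCardy_of_thm21SS_of_confInvTransport hSS (h hA) hA⟩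

end Summit.CriticalPhenomena.CardyFormulaZ2.Cruxes.BoxFamilyToCardy.Birth

end
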